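import Summits.Ventures.PercRepro.Induction
import Summits.Ventures.PercRepro.C012Partial

/-!
# C-012 along one edge: the slack is a quadratic, and the cross-term condition (BX)

For the row C-012 write `c012Slack L` for the slack of a law vector `L = (x, y₁, y₂, y₃, z)` and
`c012Bil L M` for its polarisation (`c012Bil L L = c012Slack L`). Since every cell probability is
affine in a single edge weight (`prob_split`), along an edge `e` with weight `t` the law is
`(1 − t)·L₀ + t·L₁` (`law3_split`) and the slack is the quadratic
`(1 − t)² S₀ + 2t(1 − t) B + t² S₁` (`c012Slack_combo`), `B = c012Bil L₀ L₁`.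

* `c012Slack_combo_nonneg`: if `S₀, S₁ ≥ 0` and `B ≥ −min S₀ S₁` (the condition **(BX)** of
  `proofs/P5-C012.md` §7) then the slack at `t ∈ [0, 1]` is `≥ min S₀ S₁ · (1 − 2t)² ≥ 0`.
* `law3_split`, `c012Slack_law3_split`: the same for the actual law `G.law3 p a b c`.

This is the kernel-checked half of "(BX) ⇒ C-012"; the induction over free edges (with the
re-marking of `b` inside its sure cluster for the base case) is stated in the paper note.
-/

namespace PercRepro

open Finset

/-- The C-012 slack of a law vector `(x, y₁, y₂, y₃, z)`. -/
def c012Slack (L : Fin 5 → ℝ) : ℝ :=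
  (L 1 + L 2 + L 3) * (L 0 + L 4) - (L 4 + L 1) * (L 2 + L 0)

/-- The polarisation of the C-012 slack: `c012Bil L L = c012Slack L`, symmetric, bilinear. -/
noncomputable def c012Bil (L M : Fin 5 → ℝ) : ℝ :=
  (L 3 * (M 0 + M 4) + M 3 * (L 0 + L 4) + (L 0 - L 1) * (M 2 - M 4) +
    (M 0 - M 1) * (L 2 - L 4)) / 2

/-- The polarisation on the diagonal is the slack. -/
theorem c012Bil_self (L : Fin 5 → ℝ) : c012Bil L L = c012Slack L := by
  unfold c012Bil c012Slack; ring

/-- The polarisation is symmetric. -/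
theorem c012Bil_comm (L M : Fin 5 → ℝ) : c012Bil L M = c012Bil M L := by
  unfold c012Bil; ring

/-- The slack of a convex combination of two laws is a quadratic in the mixing weight. -/
theorem c012Slack_combo (t : ℝ) (L M : Fin 5 → ℝ) :
    c012Slack (fun i => (1 - t) * L i + t * M i) =
      (1 - t) ^ 2 * c012Slack L + 2 * t * (1 - t) * c012Bil L M + t ^ 2 * c012Slack M := by
  unfold c012Bil c012Slack; ring

/-- **(BX) closes the quadratic**: if the cross term is at least `−min S₀ S₁`, the slack of the
combination is `≥ min S₀ S₁ · (1 − 2t)²` (nonnegative once `S₀, S₁ ≥ 0`). -/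
theorem c012Slack_combo_nonneg {t : ℝ} (ht0 : 0 ≤ t) (ht1 : t ≤ 1) {L M : Fin 5 → ℝ}
    (hB : -min (c012Slack L) (c012Slack M) ≤ c012Bil L M) :
    min (c012Slack L) (c012Slack M) * (1 - 2 * t) ^ 2 ≤
      c012Slack (fun i => (1 - t) * L i + t * M i) := by
  rw [c012Slack_combo]
  have hm0 : min (c012Slack L) (c012Slack M) ≤ c012Slack L := min_le_left _ _
  have hm1 : min (c012Slack L) (c012Slack M) ≤ c012Slack M := min_le_right _ _
  have ht : 0 ≤ t * (1 - t) := mul_nonneg ht0 (by linarith)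
  nlinarith [mul_le_mul_of_nonneg_left hm0 (sq_nonneg (1 - t)),
    mul_le_mul_of_nonneg_left hm1 (sq_nonneg t),
    mul_le_mul_of_nonneg_left hB ht]

namespace MultiGraph

variable {E : Type*} [Fintype E] [DecidableEq E] {V : Type*} (G : MultiGraph V E)

/-- The law `law3` is affine in each edge weight: `L(p) = (1 − p e)·L(p[e:=0]) + p e·L(p[e:=1])`. -/
theorem law3_split (p : E → ℝ) (e : E) (a b c : V) :
    G.law3 p a b c = fun i =>
      (1 - p e) * G.law3 (Function.update p e 0) a b c i +
        p e * G.law3 (Function.update p e 1) a b c i := by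
  funext i
  unfold law3
  rw [prob_split p e]
  ring

/-- The C-012 slack of `G.law3 p a b c` along the edge `e`, as the quadratic in `p e`. -/
theorem c012Slack_law3_split (p : E → ℝ) (e : E) (a b c : V) :
    c012Slack (G.law3 p a b c) =
      (1 - p e) ^ 2 * c012Slack (G.law3 (Function.update p e 0) a b c) +
        2 * p e * (1 - p e) *
          c012Bil (G.law3 (Function.update p e 0) a b c) (G.law3 (Function.update p e 1) a b c) +
        p e ^ 2 * c012Slack (G.law3 (Function.update p e 1) a b c) := by
  rw [law3_split G p e a b c, c012Slack_combo]

/-- The C-012 row inequality for `(G, p, a, b, c)` is `0 ≤ c012Slack (G.law3 p a b c)`. -/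
theorem c012_iff_slack_nonneg (p : E → ℝ) (a b c : V) :
    ((G.law3 p a b c 4 + G.law3 p a b c 1) * (G.law3 p a b c 2 + G.law3 p a b c 0) ≤
      (G.law3 p a b c 1 + G.law3 p a b c 2 + G.law3 p a b c 3) *
        (G.law3 p a b c 0 + G.law3 p a b c 4)) ↔ 0 ≤ c012Slack (G.law3 p a b c) := by
  unfold c012Slack
  constructor <;> intro h <;> linarith

/-- **One induction step of "(BX) ⇒ C-012"**: if the row holds at `p[e:=0]` and `p[e:=1]` and the
cross term at `e` satisfies (BX), it holds at `p`. -/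
theorem c012Slack_nonneg_of_bx {p : E → ℝ} (hp : IsProb p) (e : E) (a b c : V)
    (h0 : 0 ≤ c012Slack (G.law3 (Function.update p e 0) a b c))
    (h1 : 0 ≤ c012Slack (G.law3 (Function.update p e 1) a b c))
    (hB : -min (c012Slack (G.law3 (Function.update p e 0) a b c))
        (c012Slack (G.law3 (Function.update p e 1) a b c)) ≤
      c012Bil (G.law3 (Function.update p e 0) a b c) (G.law3 (Function.update p e 1) a b c)) :
    0 ≤ c012Slack (G.law3 p a b c) := by
  rw [law3_split G p e a b c]
  have hmin : 0 ≤ min (c012Slack (G.law3 (Function.update p e 0) a b c))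
      (c012Slack (G.law3 (Function.update p e 1) a b c)) := le_min h0 h1
  calc (0 : ℝ) ≤ min (c012Slack (G.law3 (Function.update p e 0) a b c))
        (c012Slack (G.law3 (Function.update p e 1) a b c)) * (1 - 2 * p e) ^ 2 :=
        mul_nonneg hmin (sq_nonneg _)
    _ ≤ _ := c012Slack_combo_nonneg (hp e).1 (hp e).2 hB

end MultiGraph

end PercRepro
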